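import Summits.QuantumFields.YangMills.Theorems.UnitScaleTiltProp7CoclosedEnergiesOfHKgK
import HarnessLib

/-!
# Route `UnitScaleTilt`, crux K1 «MinimiserStabilityRegPr» (stmt-QuantumFields-19200), route-R E′ growth side, S3 K-form engine (R5 door ✓ `Prop7ZetaRowOfEngineRows`,
# row (B) knit ✓ `Prop7CoclosedEnergiesOfHKgK.rowB_of_hKgK_T3`) — THE hKg-K SOCKET FROM TWO ROWS ABOUT THE BACKGROUND, IN THREE LINES:
# hKg-K `K_W(D_Wφ₀) ≤ C_g·K_W(D) + θ_g·e·ℓ⁻²·M(D)` with `θ_g = 0`, `C_g = 2·C_ℛ∕κ′` ⟸ (ℛ-ROW★) «`ℓ²·K_W(D_Ws) ≤ C_ℛ·Σ_b‖(D_Ws)(b)‖²` for EVERY section `s`»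
# ∧ (κ-ROW′) «K-only Hessian on the member: `κ′·ℓ⁻²·Σ_b‖D b‖² ≤ K_W(D)`» ∧ the co-closed covariant Hodge split `D = B + D_Wφ₀`

Cell `ym3-torus`, width seat `ym-ust-19200-w4` (gen 7), line HKGK-ANALYTIC (★★OWNER g28 ACK 84 (1); this seat's LOCATE-C7-RROW-w4g7 Addendum A + the located CURRENCY HAZARD
2026-08-29 00:1xZ: the κ-row must be K-ONLY — the (116)-currency row with a divergence term would feed an unabsorbable `DIV` into R5 or be circular through S3).  THEOREMS ONLY
(0 `def`, 0 `sorry`); `--supports stmt-QuantumFields-19200`, count-neutral.  YM₃ on T³ is a ladder rung (R3), not the Clay problem; nothing here claims S3, hKg-K, E′, a stub, the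
crux, d = 4 or the mass gap.

WHY.  R5 displays, inside its row (B), the alignment row hKg-K at the R2-critical background (px12 g4's socket `rowB_of_hKgK_T3`, input `hKg`).  This file reduces that input to TWO
ROWS THAT DO NOT MENTION THE COMPETITOR'S HODGE POTENTIAL: (ℛ-ROW★) a property of `W` alone — the curvature commutator `ℒ_p(D_Ws)` of ANY section `s` is `ℓ⁻²`-dominated by the
covariant gradient energy `Σ_b‖D_Ws‖²` (numerically `C_ℛ = ℓ²λ_max(GᴴCURLᴴCURL G, GᴴG) ≈ 18–20` at ℓ = 3 seeds and critical points, px8 g3 (K2); flat leading order = the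
Bernstein inequality ✓ `Prop7AliasSumBernstein.bernstein_QvOp_adjoint` + ✓ `Prop7LinAvgAdjoint`∕`Prop7LinAvgIterAdjoint`, sharp flat value 31.4 ℓ-flat, px12 g4 (K3)) — and
(κ-ROW′) the K-ONLY Hessian lower bound on the member (numerically `κ′ ≈ 8–9.8` on `S_H ∩ ker Q_W`; flat theorem ✓ `Prop7FlatHessKOnSlice.hessK_flat_on_SH_T3` modulo LEMMA H).
The three lines: `K_W(D_Wφ₀) ≤ C_ℛℓ⁻²Σ‖D_Wφ₀‖² ≤ 2C_ℛℓ⁻²Σ‖D‖² ≤ (2C_ℛ∕κ′)K_W(D)` — the middle step is the Hodge Pythagoras of the co-closed split in Hilbert–Schmidt geometry with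
op ≤ HS ≤ N·op (§1, the `D_Wφ₀`-half of ✓ `sum_norm_sq_le_of_coclosed_split`).  No spectral split, no `θ_g`, no window.

WHAT IS PROVED (ns `…Theorems.Prop7HKgKOfRRow`).
* §1 ★ `sum_norm_sq_covD_le_of_coclosed_split` (any `SU(N)`, any level): `Σ_b‖(D_Wφ₀)(b)‖² ≤ N·Σ_b‖D b‖²` for every co-closed split `D = B + D_Wφ₀`.
* §2 ★★★ `hKgK_of_RRow_kappaRow_T3` — hKg-K in ✓ `rowB_of_hKgK_T3`'s letters with `C_g := 2·C_ℛ∕κ′`, from `hR` (ℛ-ROW★, quantified over all sections, op-norm letters), `hκ`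
  (κ-ROW′ for the member's `D`) and the split; ★★ `hKgK_of_RRow_kappaRow_T3'` — the same in the socket's EXACT shape `≤ C_g·K_W(D) + 0·e·ℓ⁻²·M(D)`, so that
  `rowB_of_hKgK_T3 … (hKgK_of_RRow_kappaRow_T3' …)` inhabits R5's row (B) with `ζ_B = 16(1 + 2C_ℛ∕κ′)`, `θ_B = 792`.
HONEST SCOPE.  Algebra over two displayed rows; neither ℛ-ROW★ (at `IsCritR2 W`) nor κ-ROW′ (curved, K-only) is a theorem at curved backgrounds today (located routes: LOCATE-C7-RROW
§0.3 (α)–(δ); flat cores ✓p676293, ✓p677367 §3); constants are whatever those rows deliver.  Nothing of S3, E′ or the crux is claimed.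

References: T. Bałaban, CMP 102 (1985) 277–309 [Balaban1985Variational] ((6) p.278, (116) p.295, (135) p.298, (141)–(143), Prop. 7 p.299); CMP 99 (1985) 389–434
[Balaban1985BackgroundPropagators] ((3.4) p.391, (3.8)–(3.10) p.392, Thm 3.11 p.416); CMP 95 (1984) 17–40 [Balaban1984PropagatorsI] ((1.18) p.20, (1.31)–(1.36) pp.23–24).
-/

set_option autoImplicit false

noncomputable section

open scoped BigOperators Matrix.Norms.L2Operator Matrix

namespace Summit.QuantumFields.YangMills.Theorems.Prop7HKgKOfRRow

open Literature.MathematicalPhysics.QuantumFieldTheory.Balaban1983to89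
open B9Eq39Adjoint (R covD divB curl)
open B9TorusCalculus (torusT)
open B10Eq27TorusAxialLog (unitsField toUField unitsField_mem_unitaryUnits)
open Summit.QuantumFields.YangMills.Theorems.Prop7CovHodgeSplit (sum_trace_conjTranspose_covD_mul sum_normSq_add_eq)
open Summit.QuantumFields.YangMills.Theorems.Prop7CovariantCoercivity (sum_norm_sq_le_mul_opNorm_sq)

variable {P : Params} {i : ℕ} {N : ℕ}

/-! ## §1 ★ The `D_Wφ₀`-half of the Hodge Pythagoras for a co-closed split -/

/-- ★ **`Σ_b‖(D_Wφ₀)(b)‖² ≤ N·Σ_b‖D b‖²` FOR EVERY CO-CLOSED COVARIANT HODGE SPLIT** `D = B + D_Wφ₀`, `D*_WB = 0`: Hilbert–Schmidt Pythagoras `|D|² = |B|² + |D_Wφ₀|²` (cross term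
`Σ_x tr(φ₀ᴴ·D*_WB) = 0`, ✓ `sum_trace_conjTranspose_covD_mul`) and op ≤ HS ≤ N·op — the companion of ✓ `Prop7CoclosedEnergiesOfHKgK.sum_norm_sq_le_of_coclosed_split`.
[cite: Balaban1984PropagatorsI, (1.21) p.21; Balaban1985BackgroundPropagators, (3.8) p.392] -/
theorem sum_norm_sq_covD_le_of_coclosed_split (W : GaugeField P i (Matrix.specialUnitaryGroup (Fin N) ℂ))
    (D B : PBond P i → Matrix (Fin N) (Fin N) ℂ) (φ₀ : Site P i → Matrix (Fin N) (Fin N) ℂ)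
    (hsplit : ∀ b : PBond P i, D b = B b + covD (torusT P i) (fun κ z => unitsField (toUField W) ⟨z, κ⟩) b.dir φ₀ b.src)
    (hBc : ∀ x : Site P i, divB (torusT P i) (fun κ z => unitsField (toUField W) ⟨z, κ⟩) (fun κ z => B ⟨z, κ⟩) x = 0) :
    ∑ b : PBond P i, ‖covD (torusT P i) (fun κ z => unitsField (toUField W) ⟨z, κ⟩) b.dir φ₀ b.src‖ ^ 2 ≤ N * ∑ b : PBond P i, ‖D b‖ ^ 2 := by
  have hVu : ∀ (ν : Fin P.d) (x : Site P i),
      ((fun κ z => unitsField (toUField W) ⟨z, κ⟩) ν x : Matrix (Fin N) (Fin N) ℂ) ∈ unitary (Matrix (Fin N) (Fin N) ℂ) :=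
    fun ν x => B7Prop2Explicit.mem_unitaryUnits.mp (unitsField_mem_unitaryUnits (toUField W) _)
  -- the HS cross term vanishes
  have hcross : ∑ b : PBond P i, (((covD (torusT P i) (fun κ z => unitsField (toUField W) ⟨z, κ⟩) b.dir φ₀ b.src)ᴴ * B b).trace).re = 0 := by
    have h := sum_trace_conjTranspose_covD_mul (P := P) (i := i) (N := N) (U := fun κ z => unitsField (toUField W) ⟨z, κ⟩) hVu φ₀ (fun κ z => B ⟨z, κ⟩)
    have h0 : ∑ x : Site P i, ((φ₀ x)ᴴ * divB (torusT P i) (fun κ z => unitsField (toUField W) ⟨z, κ⟩) (fun κ z => B ⟨z, κ⟩) x).trace = 0 :=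
      Finset.sum_eq_zero fun x _ => by rw [hBc x, Matrix.mul_zero, Matrix.trace_zero]
    rw [h0] at h
    rw [← Complex.re_sum, B10StarCount.sum_pbond]
    show (∑ x : Site P i, ∑ μ : Fin P.d, ((covD (torusT P i) (fun κ z => unitsField (toUField W) ⟨z, κ⟩) μ φ₀ x)ᴴ * B ⟨x, μ⟩).trace).re = 0
    rw [h, Complex.zero_re]
  -- HS Pythagoras, bond by bond summed
  have hHS : ∑ b : PBond P i, ∑ a : Fin N, ∑ c : Fin N, Complex.normSq (D b a c)
      = ∑ b : PBond P i, ∑ a : Fin N, ∑ c : Fin N, Complex.normSq (B b a c)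
        + ∑ b : PBond P i, ∑ a : Fin N, ∑ c : Fin N, Complex.normSq ((covD (torusT P i) (fun κ z => unitsField (toUField W) ⟨z, κ⟩) b.dir φ₀ b.src) a c) := by
    have e : ∀ b : PBond P i, ∑ a : Fin N, ∑ c : Fin N, Complex.normSq (D b a c)
        = ∑ a : Fin N, ∑ c : Fin N, Complex.normSq (B b a c)
          + ∑ a : Fin N, ∑ c : Fin N, Complex.normSq ((covD (torusT P i) (fun κ z => unitsField (toUField W) ⟨z, κ⟩) b.dir φ₀ b.src) a c)
          + 2 * (((covD (torusT P i) (fun κ z => unitsField (toUField W) ⟨z, κ⟩) b.dir φ₀ b.src)ᴴ * B b).trace).re := by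
      intro b
      rw [show D b = B b + covD (torusT P i) (fun κ z => unitsField (toUField W) ⟨z, κ⟩) b.dir φ₀ b.src from hsplit b]
      exact sum_normSq_add_eq _ _
    simp only [e, Finset.sum_add_distrib, ← Finset.mul_sum, hcross, mul_zero, add_zero]
  have hposB : 0 ≤ ∑ b : PBond P i, ∑ a : Fin N, ∑ c : Fin N, Complex.normSq (B b a c) :=
    Finset.sum_nonneg fun _ _ => Finset.sum_nonneg fun _ _ => Finset.sum_nonneg fun _ _ => Complex.normSq_nonneg _
  have hnsq : ∀ X : Matrix (Fin N) (Fin N) ℂ, ∑ a : Fin N, ∑ c : Fin N, Complex.normSq (X a c) = ∑ a : Fin N, ∑ c : Fin N, ‖X a c‖ ^ 2 :=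
    fun X => Finset.sum_congr rfl fun a _ => Finset.sum_congr rfl fun c _ => Complex.normSq_eq_norm_sq _
  calc ∑ b : PBond P i, ‖covD (torusT P i) (fun κ z => unitsField (toUField W) ⟨z, κ⟩) b.dir φ₀ b.src‖ ^ 2
      ≤ ∑ b : PBond P i, ∑ a : Fin N, ∑ c : Fin N, Complex.normSq ((covD (torusT P i) (fun κ z => unitsField (toUField W) ⟨z, κ⟩) b.dir φ₀ b.src) a c) := by
        refine Finset.sum_le_sum fun b _ => ?_
        rw [hnsq]
        exact MatrixNorms.opNorm_sq_le_sum_norm_sq _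
    _ ≤ ∑ b : PBond P i, ∑ a : Fin N, ∑ c : Fin N, Complex.normSq (D b a c) := by rw [hHS]; linarith
    _ ≤ N * ∑ b : PBond P i, ‖D b‖ ^ 2 := by
        rw [Finset.mul_sum]
        refine Finset.sum_le_sum fun b _ => ?_
        rw [hnsq]
        exact sum_norm_sq_le_mul_opNorm_sq _

/-! ## §2 ★★★ hKg-K from (ℛ-ROW★) and (κ-ROW′) -/

section T3

open Literature.MathematicalPhysics.QuantumFieldTheory.Balaban1983to89.T3ContinuumYM3Torus

/-- ★★★ **THE hKg-K SOCKET FROM TWO ROWS ABOUT THE BACKGROUND.**  Member of a T³ family at background `W` (`ℓ = L^{K−n}`); a co-closed covariant Hodge split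
`D = B + D_Wφ₀` of the competitor's chart with `Dφ = D_Wφ₀` named; (ℛ-ROW★) `hR`: for EVERY section `s`, `ℓ²·K_W(D_Ws) ≤ C_ℛ·Σ_b‖(D_Ws)(b)‖²` (the curvature commutator is
`ℓ⁻²`-dominated by the covariant gradient — a property of `W` alone; at the door: at `IsCritR2 W`); (κ-ROW′) `hκ`: the K-ONLY Hessian bound `κ′·ℓ⁻²·Σ_b‖D b‖² ≤ K_W(D)` for the
member.  Then hKg-K: `K_W(Dφ) ≤ (2·C_ℛ∕κ′)·K_W(D)`. [cite: Balaban1985Variational, (6) p.278, (116) p.295, (141)-(143) p.299, Prop. 7 p.299; Balaban1985BackgroundPropagators, (3.8)-(3.10) p.392, Thm 3.11 p.416] -/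
theorem hKgK_of_RRow_kappaRow_T3 (F : T3Family) (K n : ℕ) (W : GaugeField (F.P K) 0 (Matrix.specialUnitaryGroup (Fin 2) ℂ)) {Cℛ κ' : ℝ}
    (hC : 0 ≤ Cℛ) (hκ' : 0 < κ')
    (hR : ∀ (s : Site (F.P K) 0 → Matrix (Fin 2) (Fin 2) ℂ) (Ds : PBond (F.P K) 0 → Matrix (Fin 2) (Fin 2) ℂ),
      (∀ b : PBond (F.P K) 0, Ds b = covD (torusT (F.P K) 0) (fun κ z => unitsField (toUField W) ⟨z, κ⟩) b.dir s b.src) →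
        (((F.L : ℝ) ^ (K - n)) ^ 2) * (∑ p : Plaq (F.P K) 0, ‖((Complex.I • Ds ⟨p.src, p.μ⟩) + ((W ⟨p.src, p.μ⟩ : Matrix (Fin 2) (Fin 2) ℂ) * (Complex.I • Ds ⟨p.src.shift p.μ, p.ν⟩) * star (W ⟨p.src, p.μ⟩ : Matrix (Fin 2) (Fin 2) ℂ))
            - (((W ⟨p.src, p.μ⟩ * W ⟨p.src.shift p.μ, p.ν⟩ * (W ⟨p.src.shift p.ν, p.μ⟩)⁻¹ : Matrix.specialUnitaryGroup (Fin 2) ℂ) : Matrix (Fin 2) (Fin 2) ℂ) * (Complex.I • Ds ⟨p.src.shift p.ν, p.μ⟩) * star ((W ⟨p.src, p.μ⟩ * W ⟨p.src.shift p.μ, p.ν⟩ * (W ⟨p.src.shift p.ν, p.μ⟩)⁻¹ : Matrix.specialUnitaryGroup (Fin 2) ℂ) : Matrix (Fin 2) (Fin 2) ℂ))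
            - (((GaugeField.plaqHol W p : Matrix.specialUnitaryGroup (Fin 2) ℂ) : Matrix (Fin 2) (Fin 2) ℂ) * (Complex.I • Ds ⟨p.src, p.ν⟩) * star ((GaugeField.plaqHol W p : Matrix.specialUnitaryGroup (Fin 2) ℂ) : Matrix (Fin 2) (Fin 2) ℂ)))‖ ^ 2) ≤ Cℛ * (∑ b : PBond (F.P K) 0, ‖Ds b‖ ^ 2))
    (D B : PBond (F.P K) 0 → Matrix (Fin 2) (Fin 2) ℂ) (φ₀ : Site (F.P K) 0 → Matrix (Fin 2) (Fin 2) ℂ)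
    (hsplit : ∀ b : PBond (F.P K) 0, D b = B b + covD (torusT (F.P K) 0) (fun κ z => unitsField (toUField W) ⟨z, κ⟩) b.dir φ₀ b.src)
    (hBc : ∀ x : Site (F.P K) 0, divB (torusT (F.P K) 0) (fun κ z => unitsField (toUField W) ⟨z, κ⟩) (fun κ z => B ⟨z, κ⟩) x = 0)
    (Dφ : PBond (F.P K) 0 → Matrix (Fin 2) (Fin 2) ℂ)
    (hDφ : ∀ b : PBond (F.P K) 0, Dφ b = covD (torusT (F.P K) 0) (fun κ z => unitsField (toUField W) ⟨z, κ⟩) b.dir φ₀ b.src)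
    (hκ : κ' * (((F.L : ℝ) ^ (K - n)) ^ 2)⁻¹ * (∑ b : PBond (F.P K) 0, ‖D b‖ ^ 2) ≤ (∑ p : Plaq (F.P K) 0, ‖((Complex.I • D ⟨p.src, p.μ⟩) + ((W ⟨p.src, p.μ⟩ : Matrix (Fin 2) (Fin 2) ℂ) * (Complex.I • D ⟨p.src.shift p.μ, p.ν⟩) * star (W ⟨p.src, p.μ⟩ : Matrix (Fin 2) (Fin 2) ℂ))
            - (((W ⟨p.src, p.μ⟩ * W ⟨p.src.shift p.μ, p.ν⟩ * (W ⟨p.src.shift p.ν, p.μ⟩)⁻¹ : Matrix.specialUnitaryGroup (Fin 2) ℂ) : Matrix (Fin 2) (Fin 2) ℂ) * (Complex.I • D ⟨p.src.shift p.ν, p.μ⟩) * star ((W ⟨p.src, p.μ⟩ * W ⟨p.src.shift p.μ, p.ν⟩ * (W ⟨p.src.shift p.ν, p.μ⟩)⁻¹ : Matrix.specialUnitaryGroup (Fin 2) ℂ) : Matrix (Fin 2) (Fin 2) ℂ))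
            - (((GaugeField.plaqHol W p : Matrix.specialUnitaryGroup (Fin 2) ℂ) : Matrix (Fin 2) (Fin 2) ℂ) * (Complex.I • D ⟨p.src, p.ν⟩) * star ((GaugeField.plaqHol W p : Matrix.specialUnitaryGroup (Fin 2) ℂ) : Matrix (Fin 2) (Fin 2) ℂ)))‖ ^ 2)) :
    (∑ p : Plaq (F.P K) 0, ‖((Complex.I • Dφ ⟨p.src, p.μ⟩) + ((W ⟨p.src, p.μ⟩ : Matrix (Fin 2) (Fin 2) ℂ) * (Complex.I • Dφ ⟨p.src.shift p.μ, p.ν⟩) * star (W ⟨p.src, p.μ⟩ : Matrix (Fin 2) (Fin 2) ℂ))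
            - (((W ⟨p.src, p.μ⟩ * W ⟨p.src.shift p.μ, p.ν⟩ * (W ⟨p.src.shift p.ν, p.μ⟩)⁻¹ : Matrix.specialUnitaryGroup (Fin 2) ℂ) : Matrix (Fin 2) (Fin 2) ℂ) * (Complex.I • Dφ ⟨p.src.shift p.ν, p.μ⟩) * star ((W ⟨p.src, p.μ⟩ * W ⟨p.src.shift p.μ, p.ν⟩ * (W ⟨p.src.shift p.ν, p.μ⟩)⁻¹ : Matrix.specialUnitaryGroup (Fin 2) ℂ) : Matrix (Fin 2) (Fin 2) ℂ))
            - (((GaugeField.plaqHol W p : Matrix.specialUnitaryGroup (Fin 2) ℂ) : Matrix (Fin 2) (Fin 2) ℂ) * (Complex.I • Dφ ⟨p.src, p.ν⟩) * star ((GaugeField.plaqHol W p : Matrix.specialUnitaryGroup (Fin 2) ℂ) : Matrix (Fin 2) (Fin 2) ℂ)))‖ ^ 2) ≤ (2 * Cℛ / κ') * (∑ p : Plaq (F.P K) 0, ‖((Complex.I • D ⟨p.src, p.μ⟩) + ((W ⟨p.src, p.μ⟩ : Matrix (Fin 2) (Fin 2) ℂ) * (Complex.I • D ⟨p.src.shift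 p.μ, p.ν⟩) * star (W ⟨p.src, p.μ⟩ : Matrix (Fin 2) (Fin 2) ℂ))
            - (((W ⟨p.src, p.μ⟩ * W ⟨p.src.shift p.μ, p.ν⟩ * (W ⟨p.src.shift p.ν, p.μ⟩)⁻¹ : Matrix.specialUnitaryGroup (Fin 2) ℂ) : Matrix (Fin 2) (Fin 2) ℂ) * (Complex.I • D ⟨p.src.shift p.ν, p.μ⟩) * star ((W ⟨p.src, p.μ⟩ * W ⟨p.src.shift p.μ, p.ν⟩ * (W ⟨p.src.shift p.ν, p.μ⟩)⁻¹ : Matrix.specialUnitaryGroup (Fin 2) ℂ) : Matrix (Fin 2) (Fin 2) ℂ))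
            - (((GaugeField.plaqHol W p : Matrix.specialUnitaryGroup (Fin 2) ℂ) : Matrix (Fin 2) (Fin 2) ℂ) * (Complex.I • D ⟨p.src, p.ν⟩) * star ((GaugeField.plaqHol W p : Matrix.specialUnitaryGroup (Fin 2) ℂ) : Matrix (Fin 2) (Fin 2) ℂ)))‖ ^ 2) := by
  -- the three quantities as real numbers
  set Λ : ℝ := (((F.L : ℝ) ^ (K - n)) ^ 2) with hΛdef
  set KD : ℝ := (∑ p : Plaq (F.P K) 0, ‖((Complex.I • D ⟨p.src, p.μ⟩) + ((W ⟨p.src, p.μ⟩ : Matrix (Fin 2) (Fin 2) ℂ) * (Complex.I • D ⟨p.src.shift p.μ, p.ν⟩) * star (W ⟨p.src, p.μ⟩ : Matrix (Fin 2) (Fin 2) ℂ))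
            - (((W ⟨p.src, p.μ⟩ * W ⟨p.src.shift p.μ, p.ν⟩ * (W ⟨p.src.shift p.ν, p.μ⟩)⁻¹ : Matrix.specialUnitaryGroup (Fin 2) ℂ) : Matrix (Fin 2) (Fin 2) ℂ) * (Complex.I • D ⟨p.src.shift p.ν, p.μ⟩) * star ((W ⟨p.src, p.μ⟩ * W ⟨p.src.shift p.μ, p.ν⟩ * (W ⟨p.src.shift p.ν, p.μ⟩)⁻¹ : Matrix.specialUnitaryGroup (Fin 2) ℂ) : Matrix (Fin 2) (Fin 2) ℂ))
            - (((GaugeField.plaqHol W p : Matrix.specialUnitaryGroup (Fin 2) ℂ) : Matrix (Fin 2) (Fin 2) ℂ) * (Complex.I • D ⟨p.src, p.ν⟩) * star ((GaugeField.plaqHol W p : Matrix.specialUnitaryGroup (Fin 2) ℂ) : Matrix (Fin 2) (Fin 2) ℂ)))‖ ^ 2) with hKDdef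
  set Kφ : ℝ := (∑ p : Plaq (F.P K) 0, ‖((Complex.I • Dφ ⟨p.src, p.μ⟩) + ((W ⟨p.src, p.μ⟩ : Matrix (Fin 2) (Fin 2) ℂ) * (Complex.I • Dφ ⟨p.src.shift p.μ, p.ν⟩) * star (W ⟨p.src, p.μ⟩ : Matrix (Fin 2) (Fin 2) ℂ))
            - (((W ⟨p.src, p.μ⟩ * W ⟨p.src.shift p.μ, p.ν⟩ * (W ⟨p.src.shift p.ν, p.μ⟩)⁻¹ : Matrix.specialUnitaryGroup (Fin 2) ℂ) : Matrix (Fin 2) (Fin 2) ℂ) * (Complex.I • Dφ ⟨p.src.shift p.ν, p.μ⟩) * star ((W ⟨p.src, p.μ⟩ * W ⟨p.src.shift p.μ, p.ν⟩ * (W ⟨p.src.shift p.ν, p.μ⟩)⁻¹ : Matrix.specialUnitaryGroup (Fin 2) ℂ) : Matrix (Fin 2) (Fin 2) ℂ))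
            - (((GaugeField.plaqHol W p : Matrix.specialUnitaryGroup (Fin 2) ℂ) : Matrix (Fin 2) (Fin 2) ℂ) * (Complex.I • Dφ ⟨p.src, p.ν⟩) * star ((GaugeField.plaqHol W p : Matrix.specialUnitaryGroup (Fin 2) ℂ) : Matrix (Fin 2) (Fin 2) ℂ)))‖ ^ 2) with hKφdef
  set MD : ℝ := (∑ b : PBond (F.P K) 0, ‖D b‖ ^ 2) with hMDdef
  set Mφ : ℝ := (∑ b : PBond (F.P K) 0, ‖Dφ b‖ ^ 2) with hMφdef
  have hL1 : (1 : ℝ) ≤ F.L := by exact_mod_cast F.hL.2.le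
  have hΛ : 0 < Λ := by
    have hL : (0 : ℝ) < F.L := by linarith
    rw [hΛdef]; positivity
  -- (1) ℛ-ROW★ at `s := φ₀`
  have h1 : Λ * Kφ ≤ Cℛ * Mφ := hR φ₀ Dφ hDφ
  -- (2) Hodge Pythagoras, `D_Wφ₀`-half, `N = 2`
  have h2 : Mφ ≤ 2 * MD := by
    have h := sum_norm_sq_covD_le_of_coclosed_split W D B φ₀ hsplit hBc
    have e : Mφ = ∑ b : PBond (F.P K) 0, ‖covD (torusT (F.P K) 0) (fun κ z => unitsField (toUField W) ⟨z, κ⟩) b.dir φ₀ b.src‖ ^ 2 := by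
      rw [hMφdef]; exact Finset.sum_congr rfl fun b _ => by rw [hDφ b]
    rw [e, hMDdef]
    exact_mod_cast h
  -- (3) κ-ROW′
  have h3 : MD * Λ⁻¹ ≤ KD / κ' := by
    rw [le_div_iff₀ hκ']
    calc MD * Λ⁻¹ * κ' = κ' * Λ⁻¹ * MD := by ring
      _ ≤ KD := hκ
  -- assemble
  have hK1 : Kφ ≤ Cℛ * Mφ / Λ := (le_div_iff₀' hΛ).mpr h1
  calc Kφ ≤ Cℛ * Mφ / Λ := hK1
    _ ≤ Cℛ * (2 * MD) / Λ := div_le_div_of_nonneg_right (mul_le_mul_of_nonneg_left h2 hC) hΛ.le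
    _ = 2 * Cℛ * (MD * Λ⁻¹) := by rw [div_eq_mul_inv]; ring
    _ ≤ 2 * Cℛ * (KD / κ') := mul_le_mul_of_nonneg_left h3 (by positivity)
    _ = 2 * Cℛ / κ' * KD := by rw [div_eq_mul_inv, div_eq_mul_inv]; ring

/-- ★★ **THE SAME IN THE SOCKET'S EXACT SHAPE** `K_W(Dφ) ≤ C_g·K_W(D) + θ_g·e·ℓ⁻²·M(D)` with `C_g := 2·C_ℛ∕κ′`, `θ_g := 0` — feed it to ✓ `Prop7CoclosedEnergiesOfHKgK.rowB_of_hKgK_T3`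
(`ζ_B = 16(1 + 2C_ℛ∕κ′)`, `θ_B = 792`). [cite: Balaban1985Variational, (141)-(143) p.299, Prop. 7 p.299] -/
theorem hKgK_of_RRow_kappaRow_T3' (F : T3Family) (K n : ℕ) (W : GaugeField (F.P K) 0 (Matrix.specialUnitaryGroup (Fin 2) ℂ)) {Cℛ κ' : ℝ} (e : ℝ)
    (hC : 0 ≤ Cℛ) (hκ' : 0 < κ')
    (hR : ∀ (s : Site (F.P K) 0 → Matrix (Fin 2) (Fin 2) ℂ) (Ds : PBond (F.P K) 0 → Matrix (Fin 2) (Fin 2) ℂ),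
      (∀ b : PBond (F.P K) 0, Ds b = covD (torusT (F.P K) 0) (fun κ z => unitsField (toUField W) ⟨z, κ⟩) b.dir s b.src) →
        (((F.L : ℝ) ^ (K - n)) ^ 2) * (∑ p : Plaq (F.P K) 0, ‖((Complex.I • Ds ⟨p.src, p.μ⟩) + ((W ⟨p.src, p.μ⟩ : Matrix (Fin 2) (Fin 2) ℂ) * (Complex.I • Ds ⟨p.src.shift p.μ, p.ν⟩) * star (W ⟨p.src, p.μ⟩ : Matrix (Fin 2) (Fin 2) ℂ))
            - (((W ⟨p.src, p.μ⟩ * W ⟨p.src.shift p.μ, p.ν⟩ * (W ⟨p.src.shift p.ν, p.μ⟩)⁻¹ : Matrix.specialUnitaryGroup (Fin 2) ℂ) : Matrix (Fin 2) (Fin 2) ℂ) * (Complex.I • Ds ⟨p.src.shift p.ν, p.μ⟩) * star ((W ⟨p.src, p.μ⟩ * W ⟨p.src.shift p.μ, p.ν⟩ * (W ⟨p.src.shift p.ν, p.μ⟩)⁻¹ : Matrix.specialUnitaryGroup (Fin 2) ℂ) : Matrix (Fin 2) (Fin 2) ℂ))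
            - (((GaugeField.plaqHol W p : Matrix.specialUnitaryGroup (Fin 2) ℂ) : Matrix (Fin 2) (Fin 2) ℂ) * (Complex.I • Ds ⟨p.src, p.ν⟩) * star ((GaugeField.plaqHol W p : Matrix.specialUnitaryGroup (Fin 2) ℂ) : Matrix (Fin 2) (Fin 2) ℂ)))‖ ^ 2) ≤ Cℛ * (∑ b : PBond (F.P K) 0, ‖Ds b‖ ^ 2))
    (D B : PBond (F.P K) 0 → Matrix (Fin 2) (Fin 2) ℂ) (φ₀ : Site (F.P K) 0 → Matrix (Fin 2) (Fin 2) ℂ)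
    (hsplit : ∀ b : PBond (F.P K) 0, D b = B b + covD (torusT (F.P K) 0) (fun κ z => unitsField (toUField W) ⟨z, κ⟩) b.dir φ₀ b.src)
    (hBc : ∀ x : Site (F.P K) 0, divB (torusT (F.P K) 0) (fun κ z => unitsField (toUField W) ⟨z, κ⟩) (fun κ z => B ⟨z, κ⟩) x = 0)
    (Dφ : PBond (F.P K) 0 → Matrix (Fin 2) (Fin 2) ℂ)
    (hDφ : ∀ b : PBond (F.P K) 0, Dφ b = covD (torusT (F.P K) 0) (fun κ z => unitsField (toUField W) ⟨z, κ⟩) b.dir φ₀ b.src)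
    (hκ : κ' * (((F.L : ℝ) ^ (K - n)) ^ 2)⁻¹ * (∑ b : PBond (F.P K) 0, ‖D b‖ ^ 2) ≤ (∑ p : Plaq (F.P K) 0, ‖((Complex.I • D ⟨p.src, p.μ⟩) + ((W ⟨p.src, p.μ⟩ : Matrix (Fin 2) (Fin 2) ℂ) * (Complex.I • D ⟨p.src.shift p.μ, p.ν⟩) * star (W ⟨p.src, p.μ⟩ : Matrix (Fin 2) (Fin 2) ℂ))
            - (((W ⟨p.src, p.μ⟩ * W ⟨p.src.shift p.μ, p.ν⟩ * (W ⟨p.src.shift p.ν, p.μ⟩)⁻¹ : Matrix.specialUnitaryGroup (Fin 2) ℂ) : Matrix (Fin 2) (Fin 2) ℂ) * (Complex.I • D ⟨p.src.shift p.ν, p.μ⟩) * star ((W ⟨p.src, p.μ⟩ * W ⟨p.src.shift p.μ, p.ν⟩ * (W ⟨p.src.shift p.ν, p.μ⟩)⁻¹ : Matrix.specialUnitaryGroup (Fin 2) ℂ) : Matrix (Fin 2) (Fin 2) ℂ))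
            - (((GaugeField.plaqHol W p : Matrix.specialUnitaryGroup (Fin 2) ℂ) : Matrix (Fin 2) (Fin 2) ℂ) * (Complex.I • D ⟨p.src, p.ν⟩) * star ((GaugeField.plaqHol W p : Matrix.specialUnitaryGroup (Fin 2) ℂ) : Matrix (Fin 2) (Fin 2) ℂ)))‖ ^ 2)) :
    (∑ p : Plaq (F.P K) 0, ‖((Complex.I • Dφ ⟨p.src, p.μ⟩) + ((W ⟨p.src, p.μ⟩ : Matrix (Fin 2) (Fin 2) ℂ) * (Complex.I • Dφ ⟨p.src.shift p.μ, p.ν⟩) * star (W ⟨p.src, p.μ⟩ : Matrix (Fin 2) (Fin 2) ℂ))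
            - (((W ⟨p.src, p.μ⟩ * W ⟨p.src.shift p.μ, p.ν⟩ * (W ⟨p.src.shift p.ν, p.μ⟩)⁻¹ : Matrix.specialUnitaryGroup (Fin 2) ℂ) : Matrix (Fin 2) (Fin 2) ℂ) * (Complex.I • Dφ ⟨p.src.shift p.ν, p.μ⟩) * star ((W ⟨p.src, p.μ⟩ * W ⟨p.src.shift p.μ, p.ν⟩ * (W ⟨p.src.shift p.ν, p.μ⟩)⁻¹ : Matrix.specialUnitaryGroup (Fin 2) ℂ) : Matrix (Fin 2) (Fin 2) ℂ))
            - (((GaugeField.plaqHol W p : Matrix.specialUnitaryGroup (Fin 2) ℂ) : Matrix (Fin 2) (Fin 2) ℂ) * (Complex.I • Dφ ⟨p.src, p.ν⟩) * star ((GaugeField.plaqHol W p : Matrix.specialUnitaryGroup (Fin 2) ℂ) : Matrix (Fin 2) (Fin 2) ℂ)))‖ ^ 2) ≤ (2 * Cℛ / κ') * (∑ p : Plaq (F.P K) 0, ‖((Complex.I • D ⟨p.src, p.μ⟩) + ((W ⟨p.src, p.μ⟩ : Matrix (Fin 2) (Fin 2) ℂ) * (Complex.I • D ⟨p.src.shift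 p.μ, p.ν⟩) * star (W ⟨p.src, p.μ⟩ : Matrix (Fin 2) (Fin 2) ℂ))
            - (((W ⟨p.src, p.μ⟩ * W ⟨p.src.shift p.μ, p.ν⟩ * (W ⟨p.src.shift p.ν, p.μ⟩)⁻¹ : Matrix.specialUnitaryGroup (Fin 2) ℂ) : Matrix (Fin 2) (Fin 2) ℂ) * (Complex.I • D ⟨p.src.shift p.ν, p.μ⟩) * star ((W ⟨p.src, p.μ⟩ * W ⟨p.src.shift p.μ, p.ν⟩ * (W ⟨p.src.shift p.ν, p.μ⟩)⁻¹ : Matrix.specialUnitaryGroup (Fin 2) ℂ) : Matrix (Fin 2) (Fin 2) ℂ))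
            - (((GaugeField.plaqHol W p : Matrix.specialUnitaryGroup (Fin 2) ℂ) : Matrix (Fin 2) (Fin 2) ℂ) * (Complex.I • D ⟨p.src, p.ν⟩) * star ((GaugeField.plaqHol W p : Matrix.specialUnitaryGroup (Fin 2) ℂ) : Matrix (Fin 2) (Fin 2) ℂ)))‖ ^ 2) + 0 * e * (((F.L : ℝ) ^ (K - n)) ^ 2)⁻¹ * (∑ b : PBond (F.P K) 0, ‖D b‖ ^ 2) := by
  rw [zero_mul, zero_mul, zero_mul, add_zero]
  exact hKgK_of_RRow_kappaRow_T3 F K n W hC hκ' hR D B φ₀ hsplit hBc Dφ hDφ hκ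

end T3

end Summit.QuantumFields.YangMills.Theorems.Prop7HKgKOfRRow

end
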